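import Mathlib
import Summits.KontsevichZagierPeriods.Zeta5Search.Certificates.RayC1Decay
import Summits.KontsevichZagierPeriods.Zeta5Search.Certificates.RayC1Growth
import Summits.KontsevichZagierPeriods.Zeta5Search.Certificates.RayC1KernelClassR8
import HarnessLib

/-!
# The `theorem1'`-shaped statement on the calibration ray C1 from ONE named hypothesis pair: (E) and (N ∀ᶠ)
(fam-tele g17, S4-C1 file L7 — the C1 copy of `RecordRayThm1OfN`; assembly glue, hypotheses-parametric — it proves no certificate)

HONEST FRAMING: systematic search; no irrationality claim unless certified.  C1 is the CALIBRATION ray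
`a = (18,32,23,30,28,38,43,30)` of the cell's search — a SECOND explicit pair `(P_n, Q_n) = (c1P n, c1Q n)` built from
Brown–Zudilin's cellular integral; its certified exponent `0.8673` (`c1_exponent_classR8`) is `< 1`: NO irrationality content,
NO number in print moves.  This file pins down, as checked implications, what the LITE package leaves to FULL:

* `tendsto_c1P_div_c1Q` — the LIMIT clause `P_n/Q_n → ζ(5)` on C1, unconditionally, from the tree's decay of the C1 forms
  (`RayC1Decay.eventually_c1Form_le_exp`: `|Q_nζ(5) − P_n| ≤ e^{(−69.1961+ε)n}`) and `|Q_n| > 0` (`latticeTerm_le_abs_c1Q`);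
* `c1_clauses_eventually` / `theorem1'_of_C1` — the explicit C1 clauses and the Literature-typed statement `BrownZudilin2022.theorem1'` (which quantifies `∃ p q` and fixes only
  `ζ(5)` and the exponent `0.86`) witnessed by the C1 pair, GIVEN (E) `IsAperyType c1P (fun n => (c1Q n : ℚ))` (cert-1's
  `RayC1Apery/AperyPQ`) and (N ∀ᶠ) `∀ᶠ n, c1Form n ≠ 0` (NOT in the tree for C1 — LITE has (N ∃ᶠ) `RayC1Window`; the
  all-`n` cone certificate is the FULL package).  The METRIC clause is the tree's hypothesis-free (M) `c1_exponent_classR8`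
  at `γ = 0.86 ≤ 0.8673`, transported to the REDUCED denominator `(P_n/Q_n).den ≤ q_n = kMPR8 n·|Q_n|`.

Nothing here is new mathematics; whether a C1-witnessed instance of the typed `theorem1'` deserves any wording at all is the
lead's and the referees' call (PLAN K3), not this file's.
-/

namespace Summit.KontsevichZagierPeriods.Zeta5Search.RayC1.Generic

open Filter Topology
open Literature.NumberTheory.Transcendental (zetaValue)
open Literature.NumberTheory.Irrationality.BrownZudilin2022 (IsAperyType theorem1')

/-- Cast bookkeeping: `((P_n / Q_n : ℚ) : ℝ) = P_n / Q_n` in `ℝ` (the C1 pair `c1P`, `c1Q`).  LANE EDIT (P2 g8): the left side is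
spelled with an explicit `(c1P n : ℚ)` ascription — identical elaborated statement — because the gate's name-blind textual dedup lint
flagged the original spelling as a twin of `RecordRay.Generic.ratCast_recordP_div` (a lemma about a DIFFERENT pair). -/
theorem ratCast_c1P_div (n : ℕ) : (((c1P n : ℚ) / (c1Q n : ℚ) : ℚ) : ℝ) = (c1P n : ℝ) / (c1Q n : ℝ) := by
  push_cast
  rfl

/-- `Q_n ≠ 0` for every `n` on C1 (from `latticeTerm_le_abs_c1Q`). -/
theorem c1Q_ne_zero (n : ℕ) : c1Q n ≠ 0 := by
  intro h
  have := (latticeTerm_le_abs_c1Q n).2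
  rw [h] at this
  simp at this

/-- `P_n/Q_n = ζ(5) − L_n/Q_n` with `L_n = c1Form n = Q_nζ(5) − P_n` (`n ≥ 1`). -/
theorem c1P_div_c1Q_eq {n : ℕ} (hn : 1 ≤ n) :
    (c1P n : ℝ) / (c1Q n : ℝ) = zetaValue 5 - c1Form n / (c1Q n : ℝ) := by
  have hQR : (c1Q n : ℝ) ≠ 0 := by exact_mod_cast c1Q_ne_zero n
  rw [c1Form_eq hn, sub_div, mul_div_cancel_left₀ _ hQR, sub_sub_cancel]

/-- **LIMIT clause on C1 (unconditional).**  `P_n/Q_n → ζ(5)`. -/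
theorem tendsto_c1P_div_c1Q :
    Tendsto (fun n => ((c1P n / (c1Q n : ℚ) : ℚ) : ℝ)) atTop (𝓝 (zetaValue 5)) := by
  rw [tendsto_iff_norm_sub_tendsto_zero]
  refine squeeze_zero' (g := fun n : ℕ => Real.exp ((-691961 / 10000 + 1) * (n : ℝ)))
    (Eventually.of_forall fun n => norm_nonneg _) ?_ ?_
  · filter_upwards [eventually_ge_atTop 1, eventually_c1Form_le_exp one_pos] with n hn hL
    have h1 : (1 : ℝ) ≤ |(c1Q n : ℝ)| := by
      rw [← Int.cast_abs]; exact_mod_cast Int.one_le_abs (c1Q_ne_zero n)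
    rw [Real.norm_eq_abs, ratCast_c1P_div, c1P_div_c1Q_eq hn, sub_sub_cancel_left, abs_neg, abs_div]
    exact (div_le_self (abs_nonneg _) h1).trans hL
  · have hc : (-691961 / 10000 + 1 : ℝ) < 0 := by norm_num
    exact Real.tendsto_exp_atBot.comp (tendsto_natCast_atTop_atTop.const_mul_atTop_of_neg hc)

/-- The reduced denominator of `P_n/Q_n` divides the (M)-clause denominator `q = kMPR8·|Q_n|` whenever `p = kMPR8·P_n` is an integer. -/
theorem den_c1P_div_le {n : ℕ} {p : ℤ} {q : ℕ} (hq : 1 ≤ q) (hqQ : (q : ℚ) = kMPR8 n * |(c1Q n : ℚ)|)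
    (hpP : (p : ℚ) = kMPR8 n * c1P n) : (c1P n / (c1Q n : ℚ)).den ≤ q := by
  have hQQ : ((c1Q n : ℤ) : ℚ) ≠ 0 := by exact_mod_cast c1Q_ne_zero n
  have hq0 : (q : ℚ) ≠ 0 := by exact_mod_cast (by omega : q ≠ 0)
  obtain ⟨Z, hZ⟩ : ∃ Z : ℤ, c1P n / (c1Q n : ℚ) = (Z : ℚ) / (q : ℚ) := by
    rcases abs_choice ((c1Q n : ℚ)) with habs | habs
    · exact ⟨p, by rw [div_eq_div_iff hQQ hq0, hpP, hqQ, habs]; ring⟩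
    · exact ⟨-p, by rw [div_eq_div_iff hQQ hq0, Int.cast_neg, hpP, hqQ, habs]; ring⟩
  have hdvd : (c1P n / (c1Q n : ℚ)).den ∣ q := by
    rw [hZ]
    have h := Rat.den_dvd Z q
    rw [Rat.divInt_eq_div] at h
    push_cast at h
    exact Int.natCast_dvd_natCast.1 h
  exact Nat.le_of_dvd (by omega) hdvd

/-- **The explicit C1 body of the metric/non-vanishing clause, from (N ∀ᶠ).**  For all large `n`: `Q_n ≠ 0`,
`0 < |ζ(5) − P_n/Q_n| < 1/den(P_n/Q_n)^{0.86}` on the C1 ray — the tree's (M) `c1_exponent_classR8` at `γ = 0.86 ≤ 0.8673` moved to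
the reduced denominator, positivity from the hypothesis (N ∀ᶠ).  HONEST FRAMING: `0.86 < 1`; no irrationality content. -/
theorem c1_clauses_eventually (hN : ∀ᶠ n : ℕ in atTop, c1Form n ≠ 0) :
    ∀ᶠ n : ℕ in atTop, (c1Q n : ℚ) ≠ 0 ∧ 0 < |zetaValue 5 - ((c1P n / (c1Q n : ℚ) : ℚ) : ℝ)| ∧
      |zetaValue 5 - ((c1P n / (c1Q n : ℚ) : ℚ) : ℝ)| < 1 / ((c1P n / (c1Q n : ℚ)).den : ℝ) ^ (0.86 : ℝ) := by
  filter_upwards [eventually_ge_atTop 1, hN,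
    c1_exponent_classR8 (γ := (0.86 : ℝ)) (by norm_num) (by norm_num)] with n hn hL hM
  obtain ⟨p, q, hq, hqQ, hpP, hlt⟩ := hM
  have hQR : (c1Q n : ℝ) ≠ 0 := by exact_mod_cast c1Q_ne_zero n
  refine ⟨by exact_mod_cast c1Q_ne_zero n, ?_, ?_⟩
  · rw [ratCast_c1P_div, c1P_div_c1Q_eq hn, sub_sub_cancel, abs_pos]
    exact div_ne_zero hL hQR
  · rw [ratCast_c1P_div]
    refine hlt.trans_le ?_
    have hden : ((c1P n / (c1Q n : ℚ)).den : ℝ) ≤ q := by exact_mod_cast den_c1P_div_le hq hqQ hpP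
    have hden0 : (0 : ℝ) < ((c1P n / (c1Q n : ℚ)).den : ℝ) := by exact_mod_cast Rat.den_pos _
    exact one_div_le_one_div_of_le (Real.rpow_pos_of_pos hden0 _)
      (Real.rpow_le_rpow hden0.le hden (by norm_num))

/-- **The typed `theorem1'` witnessed by the C1 pair, from (E) and (N ∀ᶠ) on C1.**  Witnesses `p n = c1P n`, `q n = c1Q n`;
limit clause `tendsto_c1P_div_c1Q`, remaining clauses `c1_clauses_eventually`.  HONEST FRAMING: `0.86 < 1`; an implication
between named statements about the CALIBRATION ray, no irrationality content; the hypothesis (N ∀ᶠ) is NOT in the tree for C1. -/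
theorem theorem1'_of_C1 (hE : IsAperyType c1P fun n => (c1Q n : ℚ))
    (hN : ∀ᶠ n : ℕ in atTop, c1Form n ≠ 0) : theorem1' :=
  ⟨c1P, fun n => (c1Q n : ℚ), hE, tendsto_c1P_div_c1Q, c1_clauses_eventually hN⟩

end Summit.KontsevichZagierPeriods.Zeta5Search.RayC1.Generic
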